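import Literature.Barriers.RiemannHypothesis.TuranPartialSumsShiftCheck
import HarnessLib

/-!
# Sections of `ζ` beyond `σ = 1`: the vertical-shift construction below `N = 360000` — the executable block checker

Barrier catalogue `Literature/Barriers/RiemannHypothesis/`, companion of
`TuranPartialSumsShiftCheck.lean` (whose scale `S = 2^60` and box helpers it reuses). PURE
COMPUTATION; its meaning is the soundness theorem of `TuranPartialSumsShiftLowSound.lean`:
`checkBlk b = true → ∀ N ∈ [b.lo, b.hi], ∃ s, 1 < Re s ∧ ζ_N(s) = 0`.

## The check

A block `b = (P, Q, a, lo, hi)` fixes the phases `ω(p) = p^{-iτ}`, `τ = a/1000`, on the primes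
`p ≤ P` (`Q` the next prime, `P² ≤ lo ≤ hi < Q²`), so that on the whole block the fixed set
`S = {p ≤ P}` and the free primes `(P, N]` of the criterion `exists_zero_of_criterion` do not jump.
At a checkpoint `N` the checker encloses `B(N) = ∑_{n ≤ N, S-smooth} n^{-1-iτ}` (through
`B(N) = S(N) − ∑_{P < p ≤ N} p^{-1-iτ} S(⌊N/p⌋)`, `S(m) = ∑_{k ≤ m} k^{-1-iτ}` from an exact table
for `m ≤ 700` and second-order Euler–Maclaurin for `m = N`) and bounds
`R(N) = ∑_{P < p ≤ N} ‖S(⌊N/p⌋)‖/p` from below; since `‖B‖` and `R` move by at most `1/(N+1)` per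
unit step of `N` inside the block, `‖B‖ < R` (and the side condition `2‖c_p‖ ≤ 2(1 + log Q)/Q < R`)
propagate to `[N, N + h]` with `2hS < (V − U)(N + 1)`; the next checkpoint is `N + h + 1`.

## References

* R. E. Moore, *Interval Analysis* (1966), Ch. 3–4. [folklore]
* The tree's `TuranPartialSumsShiftEM.lean` (Euler–Maclaurin for `S(m)`),
  `TuranPartialSumsCriterion.lean` (the criterion). [folklore]
-/

open Literature.Analysis.ValidatedNumerics.NumericsMP
open Literature.Analysis.ValidatedNumerics (Numerics.cdiv)

namespace Literature.Barriers.RiemannHypothesis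

namespace TuranShift

namespace LowCert

open Cert (S KE kE KL KP normHi normLo expNegI)

/-- Size of the exact table of `S(m)`. [folklore] -/
def K0 : ℕ := 700

/-- A block of the range `1000 < N < 360000`. [folklore] -/
structure Blk where
  /-- the largest fixed prime -/
  P : ℕ
  /-- the next prime -/
  Q : ℕ
  /-- `τ = a/1000` -/
  a : ℕ
  /-- first `N` of the block -/
  lo : ℕ
  /-- last `N` of the block -/
  hi : ℕ
  deriving DecidableEq, Repr, Inhabited

/-- The primes up to `n` (trial division). [folklore] -/
def primesUpTo (n : ℕ) : List ℕ := (List.range (n + 1)).filter Nat.Prime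

/-- `e^{−iτ log k}` for `τ = a/1000`. [folklore] -/
def phase (piI : MI) (a k : ℕ) : Option MC :=
  match MI.logNat S KL k with
  | none => none
  | some Lk => expNegI piI ((Lk.mulInt a).divNat 1000)

/-- The table `S(m) = ∑_{k ≤ m} e^{−iτ log k}/k`, `m = 0, …, n − 1` (as a list). [folklore] -/
def tableList (piI : MI) (a : ℕ) : ℕ → Option (List MC)
  | 0 => some []
  | 1 => some [MC.ofInt S 0]
  | n + 2 =>
    match tableList piI a (n + 1), phase piI a (n + 1) with
    | some l, some E =>
      match l[n]? with
      | some prev => some (l ++ [prev.add (E.divNat (n + 1))])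
      | none => none
    | _, _ => none

/-- The table as an array (`K0 + 1` entries). [folklore] -/
def table (piI : MI) (a : ℕ) : Option (Array MC) := (tableList piI a (K0 + 1)).map List.toArray

/-- `∫_1^x t^{-s} dt = (1 − x^{−iτ})(−i)/τ` from a box of `x^{−iτ}`. [folklore] -/
def powIntBox (a : ℕ) (E : MC) : MC := ((((MC.ofInt S 1).sub E).mulNegI).mulInt 1000).divNat a

/-- The Euler–Maclaurin constant `c₀(s)`: `S(K0) − ∫_1^{K0} − K0^{-s}/2`, widened by `1/(4 K0²)`
(`‖s(s+1)‖ ≤ 4` for `τ ≤ 1.1`). [folklore] -/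
def c0Box (piI : MI) (a : ℕ) (tbl : Array MC) : Option MC :=
  match tbl[K0]?, phase piI a K0 with
  | some SK, some EK =>
    some (((SK.sub (powIntBox a EK)).sub (EK.divNat (2 * K0))).widen (Numerics.cdiv (S : ℤ) (4 * K0 ^ 2)))
  | _, _ => none

/-- Enclosure of `S(N)` for `N > K0` by second-order Euler–Maclaurin. [folklore] -/
def bigSBox (piI : MI) (a : ℕ) (c0 : MC) (N : ℕ) : Option MC :=
  match phase piI a N with
  | none => none
  | some EN => some ((((powIntBox a EN).add c0).add (EN.divNat (2 * N))).widen (Numerics.cdiv (S : ℤ) (4 * N ^ 2)))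

/-- The prime sums at the checkpoint `N`: `(∑_{P<p≤N} p^{-s} S(N/p), ∑_{P<p≤N} ⌊normLo(S(N/p))/p⌋)`
over the given list of primes (accumulator form). [folklore] -/
def primeSums (piI : MI) (a P N : ℕ) (tbl : Array MC) : List ℕ → MC → ℤ → Option (MC × ℤ)
  | [], accB, accR => some (accB, accR)
  | p :: ps, accB, accR =>
    if P < p ∧ p ≤ N then
      match tbl[N / p]?, phase piI a p with
      | some Sm, some Ep =>
        primeSums piI a P N tbl ps (accB.add ((MC.mul S Ep Sm).divNat p)) (accR + (normLo Sm : ℤ) / (p : ℤ))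
      | _, _ => none
    else primeSums piI a P N tbl ps accB accR

/-- The verdict at a checkpoint: `(U, V)` with `‖B(N)‖ S ≤ U` and `V ≤ R(N) S`. [folklore] -/
def checkpoint (piI : MI) (b : Blk) (tbl : Array MC) (c0 : MC) (primes : List ℕ) (N : ℕ) : Option (ℤ × ℤ) :=
  match bigSBox piI b.a c0 N, primeSums piI b.a b.P N tbl primes (MC.ofInt S 0) 0 with
  | some SN, some (accB, accR) => some ((normHi (SN.sub accB) : ℤ), accR)
  | _, _ => none

/-- The side-condition constant `2 (1 + log Q)/Q`, scaled and rounded up. [folklore] -/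
def sideQ (Q : ℕ) : Option ℤ :=
  match MI.logNat S KL Q with
  | none => none
  | some LQ => some (Numerics.cdiv (2 * ((S : ℤ) + max LQ.hi 0)) Q)

/-- The admissible step from a checkpoint: the largest `h` with `2 h S < (V − U)(N + 1)` and
`h S < (V − side)(N + 1)` (or `none` if `V ≤ U` or `V ≤ side`). [folklore] -/
def stepOf (U V side : ℤ) (N : ℕ) : Option ℕ :=
  if U < V ∧ side < V then
    some (min (((V - U) * (N + 1) - 1) / (2 * S)).toNat (((V - side) * (N + 1) - 1) / S).toNat)
  else none

/-- The main loop: certify `[N, hi]` from successive checkpoints (`fuel` bounds their number).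
[folklore] -/
def loop (piI : MI) (b : Blk) (tbl : Array MC) (c0 : MC) (primes : List ℕ) (side : ℤ) : ℕ → ℕ → Bool
  | 0, _ => false
  | fuel + 1, N =>
    match checkpoint piI b tbl c0 primes N with
    | none => false
    | some (U, V) =>
      match stepOf U V side N with
      | none => false
      | some h => if b.hi ≤ N + h then true else loop piI b tbl c0 primes side fuel (N + h + 1)

/-- No prime strictly between `P` and `Q`. [folklore] -/
def noPrimeBetween (P Q : ℕ) : Bool :=
  ((List.range Q).filter fun r ↦ P < r).all fun r ↦ !decide (Nat.Prime r)

/-- Admissible block shape. [folklore] -/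
def Blk.ok (b : Blk) : Bool :=
  decide (Nat.Prime b.P) && decide (Nat.Prime b.Q) && noPrimeBetween b.P b.Q &&
    decide (b.P * b.P ≤ b.lo ∧ b.hi < b.Q * b.Q ∧ b.lo ≤ b.hi ∧ K0 < b.lo ∧ 0 < b.a ∧ b.a ≤ 1100 ∧ 2 ≤ b.P)

/-- **The block check** (with a supplied list of primes covering `[1, b.hi]`). [folklore] -/
def checkBlkWith (piI : MI) (primes : List ℕ) (b : Blk) : Bool :=
  b.ok &&
    match table piI b.a with
    | none => false
    | some tbl =>
      match c0Box piI b.a tbl, sideQ b.Q with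
      | some c0, some side => loop piI b tbl c0 primes side 64 b.lo
      | _, _ => false

/-- **Check a list of blocks**, sharing `π` and the prime list up to `H`. [folklore] -/
def checkBlks (H : ℕ) (bs : List Blk) : Bool :=
  match MI.pi S KP with
  | none => false
  | some piI =>
    let primes := primesUpTo H
    bs.all fun b ↦ decide (b.hi ≤ H) && checkBlkWith piI primes b

end LowCert

end TuranShift

end Literature.Barriers.RiemannHypothesis
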